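import Summits.HodgeConjecture.HodgeConjecture.Theorems.GenericDivisibilityBounded.Negative.ConiveauZeroWitness
import Literature.AlgebraicGeometry.Motives.AimedSplitProductProofs
import Literature.NumberTheory.Transcendental.DeRhamTheoremProofs

/-!
# `GenericDivisibilityBounded` (C2, stmt-HodgeConjecture-18467) · Negative · the OPEN arena of the
# heart is inhabited in Lean: a fourfold with `N¹H⁴ ≠ H⁴`

Standing disprover, cdisprove gen-2 (refuter-cdisprove-stmt-HodgeConjecture-18467-g2-0, 2026-08-17).

The line `finite-level-bootstrap` proved its heart `stub_finiteLevel` (one clean prime, `p ≥ 2`) and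
the crux C2 on every `2p`-fold with `supportedClasses X (2 * p) 1 = ⊤` (lead c4, `stub_heartOfSupportedTop`),
and reduced the crux to the heart OFF that sector (`stub_cruxOfOneCleanPrimeOffSupportedTop`, whose
hypothesis is `supportedClasses X (2 * p) 1 ≠ ⊤`). Until now no `X` satisfying that hypothesis with
`p ≥ 2` existed on the tree's carriers — the open part of the heart was about nothing constructible.
This file builds one (anti-vacuity of the heart's open sector, first rung `p = 2`):

* `supportedClasses_squareProd_four_one_ne_top` — **`N¹H⁴(((E_τ×E_τ)×(E_τ×E_τ))(ℂ); ℂ) ≠ H⁴`**: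
  the exterior square of the `(2,0)`-class `du₀ ∧ du₁` of `E_τ × E_τ` (`ConiveauZeroWitness`) is of
  type `(4,0)` (Künneth for Hodge types, Voisin I Thm. 11.38, the tree's
  `isOfHodgeType_cupProduct_map_fst_map_snd_of_multiplicative_deRham` fed with the PROVED
  multiplicative de Rham theorem `exists_deRhamIsoFamily_holds`) and non-zero (uniqueness half of
  Künneth, `Motives.cupProduct_map_fst_map_snd_ne_zero`), while `N¹ = ⊤` kills `(4,0)`-classes
  (Grothendieck (∗) / Deligne 8.2.8, proved);
* `exists_fourfold_offSupportedTop` — hence the hypothesis of `stub_cruxOfOneCleanPrimeOffSupportedTop`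
  is satisfiable at `p = 2`, with an INTEGRAL class of coniveau `0` (`existsMiddleClassOfConiveauZero_two`):
  `X = E_i⁴` is a `2p`-fold, `p = 2`, on which `stub_finiteLevel` is not settled by any landed sector
  theorem (on paper it holds at every split prime `ℓ ≡ 1 (4)`, HEART-c2 §D.1, and is OPEN at inert /
  ramified `ℓ`).
Sorry-free, definition-free; no named fact assumed.

References: [VoisinHodgeI2002] Thm. 11.38, §7.1.1; [HatcherAT2002] Thm. 3.16; [LangeBirkenhake1992]
Thm. 1.1.21; [GrothendieckTopology1969] p. 299 (∗); [DeligneHodgeIII1974] Cor. 8.2.8; [WarnerGTM94] Thm. 5.45.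
-/

noncomputable section

-- The mandated namespace `Summit.<P>.<Sub>.Theorems.…` repeats `HodgeConjecture` (single-conjunct summit).
set_option linter.dupNamespace false

open CategoryTheory AlgebraicGeometry
open scoped Manifold

namespace Summit.HodgeConjecture.HodgeConjecture.Theorems.GenericDivisibilityBounded.Negative.ArenaNonempty

open Literature.AlgebraicGeometry.Motives Literature.AlgebraicGeometry.HodgeTheory
  Literature.AlgebraicTopology.SingularHomology Literature.NumberTheory.Transcendental
open Summit.HodgeConjecture.HodgeConjecture.Theorems.GenericDivisibilityBounded.Negative.LoadBearing
open Summit.HodgeConjecture.HodgeConjecture.Theorems.GenericDivisibilityBounded.Negative.ConiveauZeroWitness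
open WeilSquare

section Fourfold

variable (τ : ℂ) (hτ : τ.im ≠ 0)

/-- `(E_τ × E_τ) × (E_τ × E_τ)` is a smooth projective fourfold. [folklore] -/
theorem isSmoothProjective_squareProd :
    IsSmoothProjective (2 + 2) ((square τ hτ).prod (square τ hτ)).X :=
  isSmoothProjective_prod (A₁ := square τ hτ) (A₂ := square τ hτ) (isSmoothProjective_square τ hτ)
    (isSmoothProjective_square τ hτ)

/-- **A non-zero `(4,0)`-class on `(E_τ × E_τ)²`**: the exterior square of `du₀ ∧ du₁`.
[cite: VoisinHodgeI2002, §11.3.2 Thm. 11.38] [cite: HatcherAT2002, §3.2 Thm. 3.16] -/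
theorem exists_ne_zero_isOfHodgeType_four_zero :
    ∃ c : complexBetti ((square τ hτ).prod (square τ hτ)).X 4, c ≠ 0 ∧
      IsOfHodgeType (2 + 2) ((square τ hτ).prod (square τ hτ)).X 4 (2 + 2) (0 + 0) c := by
  obtain ⟨c, hc0, hc⟩ := exists_ne_zero_isOfHodgeType_two_zero τ hτ
  refine ⟨cupProduct (rfl : 2 + 2 = 4)
      (complexBetti.map (AbelianVariety.fst (square τ hτ) (square τ hτ)).hom.hom.hom 2 c)
      (complexBetti.map (AbelianVariety.snd (square τ hτ) (square τ hτ)).hom.hom.hom 2 c), ?_, ?_⟩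
  · exact cupProduct_map_fst_map_snd_ne_zero (isSmoothProjective_square τ hτ)
      (isSmoothProjective_square τ hτ) (k := 4) (q := 2) (by norm_num) (by norm_num) hc0 hc0
  · exact isOfHodgeType_cupProduct_map_fst_map_snd_of_multiplicative_deRham
      (fun E _ _ _ ↦ exists_deRhamIsoFamily_holds E) (square τ hτ) (square τ hτ) 2 2
      (dim_square τ hτ) (dim_square τ hτ) 2 2 4 rfl 2 0 2 0 c c hc hc

/-- **`N¹H⁴(((E_τ × E_τ) × (E_τ × E_τ))(ℂ); ℂ) ≠ H⁴`.** [cite: GrothendieckTopology1969, p. 299 (∗) and p. 300]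
[cite: DeligneHodgeIII1974, Cor. 8.2.8] -/
theorem supportedClasses_squareProd_four_one_ne_top :
    supportedClasses ((square τ hτ).prod (square τ hτ)).X 4 1 ≠ ⊤ := by
  intro htop
  obtain ⟨c, hc0, hc⟩ := exists_ne_zero_isOfHodgeType_four_zero τ hτ
  exact hc0 (forall_isOfHodgeType_zero_eq_zero_of_supportedClasses_eq_top
    Grothendieck1969_supportedClasses_le_hodgeConiveau_holds (isSmoothProjective_squareProd τ hτ) htop c hc)

end Fourfold

/-- **Off a proper `ℂ`-submodule `N¹`, some INTEGRAL class has complexification outside it** (the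
rational classes span, each is `N⁻¹ • (z ⊗ 1)`). [cite: HatcherAT2002, §3.1 Thm. 3.2] [cite: VoisinHodgeI2002, §7.1.1] -/
theorem exists_ringChange_not_mem_of_ne_top {n k : ℕ} {X : SchemeOver ℂ} (hX : IsSmoothProjective n X)
    (h : supportedClasses X k 1 ≠ ⊤) :
    ∃ z : singularCohomology ℤ ℤ (ComplexPoints X) k,
      singularCohomology.ringChange (Int.castRingHom ℂ) (ComplexPoints X) k z ∉ supportedClasses X k 1 := by
  by_contra hall
  push Not at hall
  apply h
  rw [eq_top_iff, ← span_isRationalClass_eq_top_of_isSmoothProjective_holds n X hX k, Submodule.span_le]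
  intro c hc
  obtain ⟨N, hN, hNc⟩ := IsRationalClass.exists_nsmul_isIntegralClass hX hc
  obtain ⟨z, hz⟩ := (isIntegralClass_iff_mem_range_ringChange _).1 hNc
  have hmem := hall z
  rw [hz] at hmem
  have hN' : (N : ℂ) ≠ 0 := Nat.cast_ne_zero.2 hN.ne'
  have h' : (N : ℂ)⁻¹ • ((N : ℂ) • c) ∈ supportedClasses X k 1 := Submodule.smul_mem _ _ hmem
  rwa [smul_smul, inv_mul_cancel₀ hN', one_smul] at h'

/-- **The open sector of the heart is inhabited at `p = 2`**: a smooth projective complex fourfold with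
`supportedClasses X (2 * 2) 1 ≠ ⊤` — the hypothesis of `stub_cruxOfOneCleanPrimeOffSupportedTop`
(lead c4) and the complement of every landed sector theorem of line `finite-level-bootstrap`.
[cite: GrothendieckTopology1969, p. 300] -/
theorem exists_fourfold_offSupportedTop :
    ∃ X : SchemeOver ℂ, IsSmoothProjective (2 * 2) X ∧ supportedClasses X (2 * 2) 1 ≠ ⊤ :=
  ⟨((square Complex.I (by simp)).prod (square Complex.I (by simp))).X,
    isSmoothProjective_squareProd _ _, supportedClasses_squareProd_four_one_ne_top _ _⟩

/-- **`ExistsMiddleClassOfConiveauZero` at `p = 2` as well**: an integral class `z ∈ H⁴(E_i⁴(ℂ); ℤ)`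
whose complexification is not of coniveau `≥ 1` — the first rung of the heart (`2 ≤ p`) now has a
constructible class to be about. [cite: GrothendieckTopology1969, p. 300] -/
theorem existsMiddleClassOfConiveauZero_two :
    ∃ (X : SchemeOver ℂ) (z : singularCohomology ℤ ℤ (ComplexPoints X) (2 * 2)),
      IsSmoothProjective (2 * 2) X ∧
        singularCohomology.ringChange (Int.castRingHom ℂ) (ComplexPoints X) (2 * 2) z ∉
          supportedClasses X (2 * 2) 1 := by
  obtain ⟨X, hX, hne⟩ := exists_fourfold_offSupportedTop
  obtain ⟨z, hz⟩ := exists_ringChange_not_mem_of_ne_top hX hne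
  exact ⟨X, z, hX, hz⟩

end Summit.HodgeConjecture.HodgeConjecture.Theorems.GenericDivisibilityBounded.Negative.ArenaNonempty

end
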